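import Summits.ResolutionOfSingularities.ResolutionOfSingularities.Theses.FoliationDescent
import Literature.RingTheory.Localization.DerivationFractionField

/-!
# Crux `FolLU` (stmt-ResolutionOfSingularities-17081) — set-up of the additive witness

Route `ResolutionOfSingularities/FoliationDescent`, crux `FolLU`. Infrastructure for the negative
lemma `folLU_false_sameModel` (file `SameModel.lean` in this directory): the ORDER-OF-VANISHING
valuation at the origin on `𝔽₂[X₀,X₁]` (via Mathlib's `MvPowerSeries.order`, multiplicative because the
ring is a domain; existence form `exists_ordVal`), its extension to `K = Frac 𝔽₂[X₀,X₁]`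
(`exists_extension`), and the additive derivation `D = X₀²∂₀ + X₁²∂₁` of `K` (existence form
`exists_D`, extended from the polynomial ring by the tree's `Derivation.fractionFieldExtend`) with
`D ∘ D = 0` (characteristic two) and the growth estimate `v (D z) ≤ exp(−1) · v z` (`D` raises the
order of every monomial by one; quotient rule). Definition-free (objects are produced by existence
theorems and characterised by the predicates spelled out in the statements), kernel-only, no facts.
Refuter seat refuter-cdisprove-stmt-ResolutionOfSingularities-17081-0, 2026-08-17.
-/

set_option linter.dupNamespace false

namespace Summit.ResolutionOfSingularities.ResolutionOfSingularities.Theorems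

noncomputable section

open MvPolynomial WithZero

namespace FolLUSameModelNeg

/-! ### Order of vanishing at the origin -/

/-- Only `0` has infinite order. [folklore] -/
theorem ord_eq_top {a : (MvPolynomial (Fin 2) (ZMod 2))} : (a : (MvPowerSeries (Fin 2) (ZMod 2))).order = ⊤ ↔ a = 0 := by
  rw [MvPowerSeries.order_eq_top_iff, MvPolynomial.coe_eq_zero_iff]

/-- A non-zero coefficient bounds the order from above. [folklore] -/
theorem ord_le_degree {a : (MvPolynomial (Fin 2) (ZMod 2))} {m : Fin 2 →₀ ℕ} (h : coeff m a ≠ 0) :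
    (a : (MvPowerSeries (Fin 2) (ZMod 2))).order ≤ ((Finsupp.degree m : ℕ) : ℕ∞) := by
  apply MvPowerSeries.order_le
  rwa [MvPolynomial.coeff_coe]

/-- Coefficients below the order vanish. [folklore] -/
theorem coeff_eq_zero_of_lt_ord {a : (MvPolynomial (Fin 2) (ZMod 2))} {m : Fin 2 →₀ ℕ}
    (h : ((Finsupp.degree m : ℕ) : ℕ∞) < (a : (MvPowerSeries (Fin 2) (ZMod 2))).order) : coeff m a = 0 := by
  rw [← MvPolynomial.coeff_coe]
  exact MvPowerSeries.coeff_of_lt_order h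

/-- Vanishing of all coefficients of degree `< n` bounds the order from below. [folklore] -/
theorem le_ord {a : (MvPolynomial (Fin 2) (ZMod 2))} {n : ℕ} (h : ∀ m : Fin 2 →₀ ℕ, Finsupp.degree m < n → coeff m a = 0) :
    (n : ℕ∞) ≤ (a : (MvPowerSeries (Fin 2) (ZMod 2))).order := by
  apply MvPowerSeries.nat_le_order
  intro m hm
  rw [MvPolynomial.coeff_coe]
  exact h m (by exact_mod_cast hm)

/-- For `a ≠ 0` the natural-number order is the order. [folklore] -/
theorem ordN_spec {a : (MvPolynomial (Fin 2) (ZMod 2))} (ha : a ≠ 0) : ((a : (MvPowerSeries (Fin 2) (ZMod 2))).order.toNat : ℕ∞) = (a : (MvPowerSeries (Fin 2) (ZMod 2))).order :=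
  ENat.coe_toNat (by rwa [Ne, ord_eq_top])

/-- Additivity of the order on non-zero elements (`𝔽₂[X₀,X₁]` is a domain). [folklore] -/
theorem ordN_mul {a b : (MvPolynomial (Fin 2) (ZMod 2))} (ha : a ≠ 0) (hb : b ≠ 0) :
    ((a * b : (MvPolynomial (Fin 2) (ZMod 2))) : (MvPowerSeries (Fin 2) (ZMod 2))).order.toNat = (a : (MvPowerSeries (Fin 2) (ZMod 2))).order.toNat + (b : (MvPowerSeries (Fin 2) (ZMod 2))).order.toNat := by
  have h : ((a * b : (MvPolynomial (Fin 2) (ZMod 2))) : (MvPowerSeries (Fin 2) (ZMod 2))).order = (a : (MvPowerSeries (Fin 2) (ZMod 2))).order + (b : (MvPowerSeries (Fin 2) (ZMod 2))).order := by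
    rw [MvPolynomial.coe_mul, MvPowerSeries.order_mul]
  rw [← ordN_spec ha, ← ordN_spec hb, ← ordN_spec (mul_ne_zero ha hb)] at h
  exact_mod_cast h

/-- Ultrametric inequality for the order. [folklore] -/
theorem min_ordN_le_add {a b : (MvPolynomial (Fin 2) (ZMod 2))} (ha : a ≠ 0) (hb : b ≠ 0) (hab : a + b ≠ 0) :
    min (a : (MvPowerSeries (Fin 2) (ZMod 2))).order.toNat (b : (MvPowerSeries (Fin 2) (ZMod 2))).order.toNat ≤ ((a + b : (MvPolynomial (Fin 2) (ZMod 2))) : (MvPowerSeries (Fin 2) (ZMod 2))).order.toNat := by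
  have h : min (a : (MvPowerSeries (Fin 2) (ZMod 2))).order (b : (MvPowerSeries (Fin 2) (ZMod 2))).order ≤ ((a + b : (MvPolynomial (Fin 2) (ZMod 2))) : (MvPowerSeries (Fin 2) (ZMod 2))).order := by
    rw [MvPolynomial.coe_add]; exact MvPowerSeries.min_order_le_add
  rw [← ordN_spec ha, ← ordN_spec hb, ← ordN_spec hab] at h
  rcases le_total (a : (MvPowerSeries (Fin 2) (ZMod 2))).order.toNat (b : (MvPowerSeries (Fin 2) (ZMod 2))).order.toNat with h' | h'
  · rw [min_eq_left h']
    rw [min_eq_left (by exact_mod_cast h' : ((a : (MvPowerSeries (Fin 2) (ZMod 2))).order.toNat : ℕ∞) ≤ (b : (MvPowerSeries (Fin 2) (ZMod 2))).order.toNat)] at h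
    exact_mod_cast h
  · rw [min_eq_right h']
    rw [min_eq_right (by exact_mod_cast h' : ((b : (MvPowerSeries (Fin 2) (ZMod 2))).order.toNat : ℕ∞) ≤ (a : (MvPowerSeries (Fin 2) (ZMod 2))).order.toNat)] at h
    exact_mod_cast h

/-- The variables have order one. [folklore] -/
theorem ordN_X (i : Fin 2) : ((X i : (MvPolynomial (Fin 2) (ZMod 2))) : (MvPowerSeries (Fin 2) (ZMod 2))).order.toNat = 1 := by
  have hX : ((X i : (MvPolynomial (Fin 2) (ZMod 2))) : (MvPowerSeries (Fin 2) (ZMod 2))).order = 1 := by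
    rw [MvPolynomial.coe_X, MvPowerSeries.X, MvPowerSeries.order_monomial_of_ne_zero one_ne_zero,
      Finsupp.degree_single]
    rfl
  rw [hX, ENat.toNat_one]

/-- Order zero means non-vanishing constant coefficient. [folklore] -/
theorem ordN_eq_zero_iff {b : (MvPolynomial (Fin 2) (ZMod 2))} (hb : b ≠ 0) : (b : (MvPowerSeries (Fin 2) (ZMod 2))).order.toNat = 0 ↔ constantCoeff b ≠ 0 := by
  constructor
  · intro h0
    obtain ⟨d, hd, hdeg⟩ := MvPowerSeries.exists_coeff_ne_zero_and_order (ordN_spec hb)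
    have hdeg0 : Finsupp.degree d = 0 := by
      have : ((Finsupp.degree d : ℕ) : ℕ∞) = (((b : (MvPowerSeries (Fin 2) (ZMod 2))).order.toNat : ℕ) : ℕ∞) := by
        rw [hdeg, ordN_spec hb]
      have := ENat.coe_inj.mp this
      rw [this, h0]
    rw [Finsupp.degree_eq_zero_iff] at hdeg0
    subst hdeg0
    rwa [MvPolynomial.coeff_coe, ← MvPolynomial.constantCoeff_eq] at hd
  · intro hc
    have h := ord_le_degree (a := b) (m := 0) (by rw [← MvPolynomial.constantCoeff_eq]; exact hc)
    rw [map_zero, ← ordN_spec hb] at h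
    have : (b : (MvPowerSeries (Fin 2) (ZMod 2))).order.toNat ≤ 0 := by exact_mod_cast h
    omega

/-! ### The order valuation (existence form) and its values -/

/-- **The order-of-vanishing valuation at the origin on `𝔽₂[X₀,X₁]`** exists:
`v₀ a = exp (−ord a)` (`0` at `a = 0`). [folklore] -/
theorem exists_ordVal : ∃ v₀ : Valuation (MvPolynomial (Fin 2) (ZMod 2)) ℤᵐ⁰,
    ∀ a : (MvPolynomial (Fin 2) (ZMod 2)), v₀ a = if a = 0 then 0 else exp (-((a : (MvPowerSeries (Fin 2) (ZMod 2))).order.toNat : ℤ)) := by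
  refine ⟨{ toFun := fun a => if a = 0 then 0 else exp (-((a : (MvPowerSeries (Fin 2) (ZMod 2))).order.toNat : ℤ))
            map_zero' := if_pos rfl
            map_one' := ?_, map_mul' := ?_, map_add_le_max' := ?_ }, fun a => rfl⟩
  · rw [if_neg one_ne_zero]
    have : ((1 : (MvPolynomial (Fin 2) (ZMod 2))) : (MvPowerSeries (Fin 2) (ZMod 2))).order.toNat = 0 := (ordN_eq_zero_iff one_ne_zero).mpr (by simp)
    rw [this]
    simp
  · intro a b
    by_cases ha : a = 0
    · simp [ha]
    by_cases hb : b = 0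
    · simp [hb]
    rw [if_neg (mul_ne_zero ha hb), if_neg ha, if_neg hb, ordN_mul ha hb, ← exp_add]
    congr 1
    push_cast
    ring
  · intro a b
    by_cases hab : a + b = 0
    · rw [hab, if_pos rfl]; exact zero_le
    by_cases ha : a = 0
    · subst ha; rw [zero_add]; exact le_max_right _ _
    by_cases hb : b = 0
    · subst hb; rw [add_zero]; exact le_max_left _ _
    rw [if_neg hab, if_neg ha, if_neg hb]
    have h := min_ordN_le_add ha hb hab
    rcases le_total (a : (MvPowerSeries (Fin 2) (ZMod 2))).order.toNat (b : (MvPowerSeries (Fin 2) (ZMod 2))).order.toNat with h' | h'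
    · rw [min_eq_left h'] at h
      exact le_max_of_le_left (exp_le_exp.mpr (by omega))
    · rw [min_eq_right h'] at h
      exact le_max_of_le_right (exp_le_exp.mpr (by omega))

section OrdVal

variable (v₀ : Valuation (MvPolynomial (Fin 2) (ZMod 2)) ℤᵐ⁰)
  (hv : ∀ a : (MvPolynomial (Fin 2) (ZMod 2)), v₀ a = if a = 0 then 0 else exp (-((a : (MvPowerSeries (Fin 2) (ZMod 2))).order.toNat : ℤ)))
include hv

/-- `v₀ a = exp (−ord a)` for `a ≠ 0`. [folklore] -/
theorem ordVal_of_ne_zero {a : (MvPolynomial (Fin 2) (ZMod 2))} (ha : a ≠ 0) : v₀ a = exp (-((a : (MvPowerSeries (Fin 2) (ZMod 2))).order.toNat : ℤ)) := by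
  rw [hv a, if_neg ha]

/-- Polynomials have order `≥ 0`. [folklore] -/
theorem ordVal_le_one (a : (MvPolynomial (Fin 2) (ZMod 2))) : v₀ a ≤ 1 := by
  by_cases ha : a = 0
  · rw [ha, map_zero]; exact zero_le
  rw [ordVal_of_ne_zero v₀ hv ha, ← exp_zero, exp_le_exp]
  omega

/-- `v₀ Xᵢ = exp (−1)`. [folklore] -/
theorem ordVal_X (i : Fin 2) : v₀ (X i) = exp (-1) := by
  rw [ordVal_of_ne_zero v₀ hv (X_ne_zero i), ordN_X]; rfl

/-- `v₀ b = 1` iff `b(0) ≠ 0` (`b` is a unit of the local ring at the origin). [folklore] -/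
theorem ordVal_eq_one_iff {b : (MvPolynomial (Fin 2) (ZMod 2))} (hb : b ≠ 0) : v₀ b = 1 ↔ constantCoeff b ≠ 0 := by
  rw [ordVal_of_ne_zero v₀ hv hb, ← exp_zero, exp_inj, ← ordN_eq_zero_iff hb]
  omega

/-- **`X₀²∂₀ + X₁²∂₁` lowers the value by at least `exp(−1)`** (raises the order by one): every
monomial is sent to monomials of degree one higher. [folklore] -/
theorem ordVal_d_le (a : (MvPolynomial (Fin 2) (ZMod 2))) :
    v₀ (X 0 ^ 2 * pderiv 0 a + X 1 ^ 2 * pderiv 1 a) ≤ exp (-1) * v₀ a := by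
  by_cases ha : a = 0
  · simp [ha]
  set d := X 0 ^ 2 * pderiv 0 a + X 1 ^ 2 * pderiv 1 a with hd_def
  by_cases hd : d = 0
  · rw [hd, map_zero]; exact zero_le
  have hgrow : ((a : (MvPowerSeries (Fin 2) (ZMod 2))).order.toNat + 1 : ℕ) ≤ (d : (MvPowerSeries (Fin 2) (ZMod 2))).order := by
    apply le_ord
    intro m hm
    rw [hd_def, coeff_add]
    have key : ∀ i : Fin 2, coeff m (X i ^ 2 * pderiv i a) = 0 := by
      intro i
      rw [X_pow_eq_monomial, coeff_monomial_mul']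
      split_ifs with hle
      · rw [one_mul, coeff_pderiv]
        have hdeg : Finsupp.degree (m - Finsupp.single i 2 + Finsupp.single i 1) <
            (a : (MvPowerSeries (Fin 2) (ZMod 2))).order.toNat := by
          have h1 : m = (m - Finsupp.single i 2) + Finsupp.single i 2 :=
            (tsub_add_cancel_of_le hle).symm
          have h2 : Finsupp.degree m = Finsupp.degree (m - Finsupp.single i 2) + 2 := by
            conv_lhs => rw [h1]
            rw [map_add, Finsupp.degree_single]
          rw [map_add, Finsupp.degree_single]
          omega
        rw [coeff_eq_zero_of_lt_ord, zero_mul]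
        rw [← ordN_spec ha]
        exact_mod_cast hdeg
      · rfl
    rw [key 0, key 1, add_zero]
  rw [ordVal_of_ne_zero v₀ hv ha, ordVal_of_ne_zero v₀ hv hd, ← exp_add, exp_le_exp]
  rw [← ordN_spec hd] at hgrow
  have : (a : (MvPowerSeries (Fin 2) (ZMod 2))).order.toNat + 1 ≤ (d : (MvPowerSeries (Fin 2) (ZMod 2))).order.toNat := by exact_mod_cast hgrow
  omega

/-- The order valuation extends to `K = Frac 𝔽₂[X₀,X₁]`. [folklore] -/
theorem exists_extension : ∃ v : Valuation (FractionRing (MvPolynomial (Fin 2) (ZMod 2))) ℤᵐ⁰, ∀ a : (MvPolynomial (Fin 2) (ZMod 2)), v (algebraMap (MvPolynomial (Fin 2) (ZMod 2)) (FractionRing (MvPolynomial (Fin 2) (ZMod 2))) a) = v₀ a := by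
  have hsupp : nonZeroDivisors (MvPolynomial (Fin 2) (ZMod 2)) ≤ v₀.supp.primeCompl := by
    intro s hs
    change s ∉ v₀.supp
    rw [Valuation.mem_supp_iff, ordVal_of_ne_zero v₀ hv (nonZeroDivisors.ne_zero hs)]
    exact exp_ne_zero
  exact ⟨v₀.extendToLocalization hsupp (FractionRing (MvPolynomial (Fin 2) (ZMod 2))), fun a => Valuation.extendToLocalization_apply_map_apply _ _ _ a⟩

end OrdVal

/-! ### The additive derivation `D = X₀²∂₀ + X₁²∂₁` on `K` -/

/-- `K` has characteristic two. [folklore] -/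
theorem charP_frac : CharP (FractionRing (MvPolynomial (Fin 2) (ZMod 2))) 2 :=
  charP_of_injective_algebraMap (algebraMap (ZMod 2) (FractionRing (MvPolynomial (Fin 2) (ZMod 2)))).injective 2

/-- In characteristic two the square of a derivation is a derivation (existence form). [folklore] -/
theorem exists_sq {B : Type} [CommRing B] [Algebra (ZMod 2) B] [CharP B 2]
    (δ : Derivation (ZMod 2) B B) : ∃ δ₂ : Derivation (ZMod 2) B B, ∀ b, δ₂ b = δ (δ b) := by
  refine ⟨{ toLinearMap := (δ : B →ₗ[ZMod 2] B).comp (δ : B →ₗ[ZMod 2] B)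
            map_one_eq_zero' := by simp
            leibniz' := ?_ }, fun b => rfl⟩
  intro a b
  simp only [LinearMap.coe_comp, Function.comp_apply, Derivation.coeFn_coe, Derivation.leibniz,
    map_add, smul_eq_mul, Derivation.leibniz]
  have h2 : (2 : B) = 0 := CharTwo.two_eq_zero
  linear_combination (δ a * δ b) * h2

/-- **The additive derivation exists**: a `𝔽₂`-derivation `D` of `K` extending `X₀²∂₀ + X₁²∂₁`,
with `D ∘ D = 0`. [folklore] -/
theorem exists_D : ∃ D : Derivation (ZMod 2) (FractionRing (MvPolynomial (Fin 2) (ZMod 2))) (FractionRing (MvPolynomial (Fin 2) (ZMod 2))),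
    (∀ a : (MvPolynomial (Fin 2) (ZMod 2)), D (algebraMap (MvPolynomial (Fin 2) (ZMod 2)) (FractionRing (MvPolynomial (Fin 2) (ZMod 2))) a) = algebraMap (MvPolynomial (Fin 2) (ZMod 2)) (FractionRing (MvPolynomial (Fin 2) (ZMod 2))) (X 0 ^ 2 * pderiv 0 a + X 1 ^ 2 * pderiv 1 a))
    ∧ ∀ z : (FractionRing (MvPolynomial (Fin 2) (ZMod 2))), D (D z) = 0 := by
  let d₀ : Derivation (ZMod 2) (MvPolynomial (Fin 2) (ZMod 2)) (MvPolynomial (Fin 2) (ZMod 2)) := (X 0 ^ 2 : (MvPolynomial (Fin 2) (ZMod 2))) • pderiv 0 + (X 1 ^ 2 : (MvPolynomial (Fin 2) (ZMod 2))) • pderiv 1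
  have d₀_apply : ∀ a, d₀ a = X 0 ^ 2 * pderiv 0 a + X 1 ^ 2 * pderiv 1 a := fun a => by
    simp [d₀, smul_eq_mul]
  have d₀_X : ∀ i : Fin 2, d₀ (X i) = X i ^ 2 := by
    intro i
    rw [d₀_apply]
    fin_cases i
    · simp [pderiv_X_of_ne (show (0 : Fin 2) ≠ 1 by decide)]
    · simp [pderiv_X_of_ne (show (1 : Fin 2) ≠ 0 by decide)]
  have d₀_d₀ : ∀ a, d₀ (d₀ a) = 0 := by
    obtain ⟨δ₂, hδ₂⟩ := exists_sq d₀
    have h : δ₂ = 0 := by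
      apply MvPolynomial.derivation_ext
      intro i
      rw [Derivation.zero_apply, hδ₂, d₀_X, Derivation.leibniz_pow, d₀_X]
      simp only [nsmul_eq_mul, Nat.cast_ofNat, CharTwo.two_eq_zero, zero_mul]
    intro a
    rw [← hδ₂, h, Derivation.zero_apply]
  let dK : Derivation (ZMod 2) (MvPolynomial (Fin 2) (ZMod 2)) (FractionRing (MvPolynomial (Fin 2) (ZMod 2))) := (Algebra.linearMap (MvPolynomial (Fin 2) (ZMod 2)) (FractionRing (MvPolynomial (Fin 2) (ZMod 2)))).compDer d₀
  let D : Derivation (ZMod 2) (FractionRing (MvPolynomial (Fin 2) (ZMod 2))) (FractionRing (MvPolynomial (Fin 2) (ZMod 2))) := dK.fractionFieldExtend (F := (FractionRing (MvPolynomial (Fin 2) (ZMod 2)))) (K := (FractionRing (MvPolynomial (Fin 2) (ZMod 2))))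
  have hD : ∀ a : (MvPolynomial (Fin 2) (ZMod 2)), D (algebraMap (MvPolynomial (Fin 2) (ZMod 2)) (FractionRing (MvPolynomial (Fin 2) (ZMod 2))) a) = algebraMap (MvPolynomial (Fin 2) (ZMod 2)) (FractionRing (MvPolynomial (Fin 2) (ZMod 2))) (d₀ a) := fun a => by
    rw [Derivation.fractionFieldExtend_algebraMap]; rfl
  refine ⟨D, fun a => by rw [hD, d₀_apply], ?_⟩
  haveI := charP_frac
  obtain ⟨D₂, hD₂⟩ := exists_sq D
  have h : D₂ = 0 := by
    apply Derivation.eq_zero_of_forall_algebraMap (A := (MvPolynomial (Fin 2) (ZMod 2)))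
    intro a
    rw [hD₂, hD, hD, d₀_d₀, map_zero]
  intro z
  rw [← hD₂, h, Derivation.zero_apply]

/-- **Growth of the order under `D` on all of `K`** (quotient rule): `v (D z) ≤ exp(−1) · v z` for the
extension `v` of the order valuation and any derivation extending `X₀²∂₀ + X₁²∂₁`. [folklore] -/
theorem extension_D_le (v₀ : Valuation (MvPolynomial (Fin 2) (ZMod 2)) ℤᵐ⁰)
    (hv : ∀ a : (MvPolynomial (Fin 2) (ZMod 2)), v₀ a = if a = 0 then 0 else exp (-((a : (MvPowerSeries (Fin 2) (ZMod 2))).order.toNat : ℤ)))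
    (v : Valuation (FractionRing (MvPolynomial (Fin 2) (ZMod 2))) ℤᵐ⁰) (hvK : ∀ a : (MvPolynomial (Fin 2) (ZMod 2)), v (algebraMap (MvPolynomial (Fin 2) (ZMod 2)) (FractionRing (MvPolynomial (Fin 2) (ZMod 2))) a) = v₀ a)
    (D : Derivation (ZMod 2) (FractionRing (MvPolynomial (Fin 2) (ZMod 2))) (FractionRing (MvPolynomial (Fin 2) (ZMod 2))))
    (hD : ∀ a : (MvPolynomial (Fin 2) (ZMod 2)), D (algebraMap (MvPolynomial (Fin 2) (ZMod 2)) (FractionRing (MvPolynomial (Fin 2) (ZMod 2))) a) = algebraMap (MvPolynomial (Fin 2) (ZMod 2)) (FractionRing (MvPolynomial (Fin 2) (ZMod 2))) (X 0 ^ 2 * pderiv 0 a + X 1 ^ 2 * pderiv 1 a))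
    (z : (FractionRing (MvPolynomial (Fin 2) (ZMod 2)))) : v (D z) ≤ exp (-1) * v z := by
  obtain ⟨a, b, hb, rfl⟩ := IsFractionRing.div_surjective (A := (MvPolynomial (Fin 2) (ZMod 2))) z
  have hbK : algebraMap (MvPolynomial (Fin 2) (ZMod 2)) (FractionRing (MvPolynomial (Fin 2) (ZMod 2))) b ≠ 0 := IsFractionRing.to_map_ne_zero_of_mem_nonZeroDivisors hb
  set α := algebraMap (MvPolynomial (Fin 2) (ZMod 2)) (FractionRing (MvPolynomial (Fin 2) (ZMod 2))) a
  set β := algebraMap (MvPolynomial (Fin 2) (ZMod 2)) (FractionRing (MvPolynomial (Fin 2) (ZMod 2))) b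
  have hquot : D (α / β) = (β * D α - α * D β) / β ^ 2 := by
    rw [Derivation.leibniz_div, smul_eq_mul, smul_eq_mul, smul_eq_mul, inv_pow, div_eq_inv_mul]
  rw [hquot, map_div₀, map_pow, map_div₀]
  have hβ : v β ≠ 0 := (Valuation.ne_zero_iff _).mpr hbK
  have hnum : v (β * D α - α * D β) ≤ exp (-1) * (v α * v β) := by
    have e1 : v (β * D α) ≤ exp (-1) * (v α * v β) := by
      rw [Valuation.map_mul, hD, hvK, hvK, hvK]
      calc v₀ b * v₀ _ ≤ v₀ b * (exp (-1) * v₀ a) := mul_le_mul' le_rfl (ordVal_d_le v₀ hv a)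
        _ = exp (-1) * (v₀ a * v₀ b) := by ac_rfl
    have e2 : v (α * D β) ≤ exp (-1) * (v α * v β) := by
      rw [Valuation.map_mul, hD, hvK, hvK, hvK]
      calc v₀ a * v₀ _ ≤ v₀ a * (exp (-1) * v₀ b) := mul_le_mul' le_rfl (ordVal_d_le v₀ hv b)
        _ = exp (-1) * (v₀ a * v₀ b) := by ac_rfl
    exact (Valuation.map_sub _ _ _).trans (max_le e1 e2)
  calc v (β * D α - α * D β) / v β ^ 2 ≤ exp (-1) * (v α * v β) / v β ^ 2 := by
        rw [div_eq_mul_inv, div_eq_mul_inv]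
        exact mul_le_mul' hnum le_rfl
    _ = exp (-1) * (v α / v β) := by
        rw [sq, mul_div_assoc, mul_div_mul_right _ _ hβ]

end FolLUSameModelNeg

end

end Summit.ResolutionOfSingularities.ResolutionOfSingularities.Theorems
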